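import Summits.MatrixMultiplication.OmegaCensus.STPPSmallPatternT1Below24
import Summits.MatrixMultiplication.OmegaCensus.STPPRepresentationCount
import Summits.MatrixMultiplication.OmegaCensus.STPPRoleSymmetry

/-!
# ω-census, small pattern `(2,1,1)^k`: the packing law `3k ≤ |H| + 1` in every finite abelian group

Cell `pub-omega`, ω construction census, seat pub-omega ENG2 (gen 32). HONEST FRAMING (verbatim): lottery ticket; floor =
certified bounds/negative ranges.  Census STRUCTURE bookkeeping (column B5: `T1(H)` = max `k` with `(2,1,1)^k ⊆ H`, CKSU 2005
Def. 5.1, tree `IsSTPP`); nothing here bears on `ω`.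

The tree bounds `T1` by volume packing, `2k ≤ |H|` (`two_mul_le_card_of_isSTPP_211`; it is also what the tensor-rank filter
`sum_card_mul_le_card_of_isSTPP_of_thin` gives for this thin pattern, `R(⟨2,1,1⟩) = 2`).  A one-line counting argument on the
difference model (`exists_isSTPP_211_iff`, `STPPSmallPatternCriteria.lean`) improves it to **`3k ≤ |H| + 1`** for every finite abelian
group `H`: write the family as disjoint pairs `Aᵢ = {pᵢ, qᵢ}`, `Bᵢ = {0}`, `Cᵢ = {cᵢ}` with `x − y ≠ cⱼ − c_l` for `x ∈ Aᵢ`,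
`y ∈ A_l`, `j ≠ l`.  Fix the index `0`.  The `2k` elements `x − p₀` (`x ∈ ⋃ Aᵢ`) are pairwise distinct, the `k` elements
`cⱼ − c₀` are pairwise distinct (taking `x = y = p_l` in the criterion gives `cⱼ ≠ c_l`), and the two sets meet only in `0`
(the criterion with `y = p₀ ∈ A₀`, `l = 0`, `j ≠ 0`): so `2k + k − 1 ≤ |H|`.

Results: `three_mul_le_card_succ_of_isSTPP_211` (`Fintype.card`), `three_mul_le_natCard_succ_of_isSTPP_211` (`Nat.card`), and
the contrapositive `not_exists_isSTPP_211_of_card_lt`.  As a law for STRUCTURE B5: `T1(H) ≤ (|H| + 1)/3` for every finite abelian `H`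
(census data: `T1(H) ≈ |H|/5.5` at small orders; onsets `6, 12, 18, 24, 30, 38` vs. this bound's `5, 8, 11, 14, 17, 20` — a law, not a
tight one).  No statement about `(1,2,2)^k` is made (there the rank filter's `4k ≤ |H|` is already in the tree and this count does not beat it).

References: H. Cohn, R. Kleinberg, B. Szegedy, C. Umans, *Group-theoretic algorithms for matrix multiplication*, FOCS 2005
(arXiv:math/0511460), Def. 5.1.  Seat pub-omega ENG2 (gen 32), 2026-08-28.
-/

open Literature.Computability.AlgebraicComplexity Finset

namespace Summit.MatrixMultiplication.OmegaCensus

variable {H : Type*} [AddCommGroup H]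

/-- **Packing law for `(2,1,1)^k`: `3k ≤ |H| + 1`** in every finite abelian group `H` hosting `(2,1,1)^k` (counting the translates
`x − p₀`, `x ∈ ⋃ Aᵢ`, and the differences `cⱼ − c₀` of the difference model, which overlap only in `0`).
[cite: CohnKleinbergSzegedyUmans2005, Def. 5.1] -/
theorem three_mul_le_card_succ_of_isSTPP_211 [Fintype H] [DecidableEq H] {k : ℕ}
    (h : ∃ A B C : Fin k → Finset H, IsSTPP A B C ∧ ∀ i, (A i).card = 2 ∧ (B i).card = 1 ∧ (C i).card = 1) :
    3 * k ≤ Fintype.card H + 1 := by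
  rcases Nat.eq_zero_or_pos k with hk | hk
  · subst hk; simp
  obtain ⟨p, q, c, hpq, hD, hX⟩ := exists_isSTPP_211_iff.1 h
  set i₀ : Fin k := ⟨0, hk⟩ with hi₀
  -- the union of the pairs has 2k elements
  set A : Finset H := Finset.univ.biUnion fun i : Fin k => ({p i, q i} : Finset H) with hA
  have hAcard : A.card = 2 * k := by
    rw [hA, Finset.card_biUnion (fun i _ j _ hij => hD i j hij), Finset.sum_congr rfl (fun i _ => Finset.card_pair (hpq i)),
      Finset.sum_const, Finset.card_univ, Fintype.card_fin, smul_eq_mul, mul_comm]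
  -- U = A - p₀ (a translate), V = {c j - c 0}
  set U : Finset H := A.image (fun x => x - p i₀) with hU
  set V : Finset H := Finset.univ.image (fun j : Fin k => c j - c i₀) with hV
  have hUcard : U.card = 2 * k := by
    rw [hU, Finset.card_image_of_injective _ (sub_left_injective), hAcard]
  have hc_inj : Function.Injective c := by
    intro j l hjl
    by_contra hne
    have := hX l j l hne (p l) (by simp) (p l) (by simp)
    exact this (by rw [sub_self, hjl, sub_self])
  have hVcard : V.card = k := by
    rw [hV, Finset.card_image_of_injective _ (fun j l (hjl : c j - c i₀ = c l - c i₀) => hc_inj (sub_left_injective hjl)),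
      Finset.card_univ, Fintype.card_fin]
  -- U ∩ V ⊆ {0}
  have hUV : U ∩ V ⊆ {0} := by
    intro z hz
    rw [Finset.mem_inter] at hz
    obtain ⟨hzU, hzV⟩ := hz
    rw [hU, Finset.mem_image] at hzU
    obtain ⟨x, hxA, rfl⟩ := hzU
    rw [hV, Finset.mem_image] at hzV
    obtain ⟨j, -, hj⟩ := hzV
    rw [Finset.mem_singleton]
    by_cases hj0 : j = i₀
    · rw [← hj, hj0, sub_self]
    · exfalso
      rw [hA, Finset.mem_biUnion] at hxA
      obtain ⟨i, -, hxi⟩ := hxA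
      exact hX i j i₀ hj0 x hxi (p i₀) (by simp) hj.symm
  have hinter : (U ∩ V).card ≤ 1 := (Finset.card_le_card hUV).trans (by simp)
  have hunion : (U ∪ V).card ≤ Fintype.card H := Finset.card_le_univ _
  have := Finset.card_union_add_card_inter U V
  omega

/-- `Nat.card` form of the packing law `3k ≤ |H| + 1`. [cite: CohnKleinbergSzegedyUmans2005, Def. 5.1] -/
theorem three_mul_le_natCard_succ_of_isSTPP_211 [Finite H] {k : ℕ}
    (h : ∃ A B C : Fin k → Finset H, IsSTPP A B C ∧ ∀ i, (A i).card = 2 ∧ (B i).card = 1 ∧ (C i).card = 1) :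
    3 * k ≤ Nat.card H + 1 := by
  classical
  cases nonempty_fintype H
  rw [Nat.card_eq_fintype_card]; exact three_mul_le_card_succ_of_isSTPP_211 h

/-- Contrapositive: **no finite abelian group of order `< 3k − 1` hosts `(2,1,1)^k`.** [cite: CohnKleinbergSzegedyUmans2005, Def. 5.1] -/
theorem not_exists_isSTPP_211_of_card_lt [Finite H] {k : ℕ} (hH : Nat.card H + 1 < 3 * k) :
    ¬ ∃ A B C : Fin k → Finset H, IsSTPP A B C ∧ ∀ i, (A i).card = 2 ∧ (B i).card = 1 ∧ (C i).card = 1 :=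
  fun h => absurd (three_mul_le_natCard_succ_of_isSTPP_211 h) (by omega)

/-!
# APPEND (ENG2 gen 33, 2026-08-28): the tree's filter N9 gives `4k ≤ |H| + 2`

The count above (`3k ≤ |H| + 1`) is the `B`-shared reading of the representation-count filter N9 (`CubeNB.n9`,
`STPPRepresentationCount.lean`, seat stpp-1: `Σᵢ|Aᵢ||Bᵢ| + Σᵢ|Bᵢ||Cᵢ| ≤ |H| + |Bⱼ|`).  Reading N9 on the role-rotated family
`(C, A, B)` (`isSTPP_roles_CAB`, `STPPRoleSymmetry.lean`), whose shared letter is the PAIR `Aⱼ`, gives the better law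
**`Σ|Cᵢ||Aᵢ| + Σ|Aᵢ||Bᵢ| = 2k + 2k ≤ |H| + 2`, i.e. `4k ≤ |H| + 2`, `T1(H) ≤ (|H| + 2)/4`** for every finite abelian `H` — exact at
`k = 1` (`ℤ/2`) and `k = 2` (`ℤ/6`, the onset); census onsets `6, 12, 16, 24, 30, 38, 48` vs. this law's `6, 10, 14, 18, 22, 26, 30`.
Nothing new is proved about STPP here: this is the tree's N9, instantiated so that column B5 carries the right linear law.
-/

/-- **Packing law for `(2,1,1)^k` from filter N9: `4k ≤ |H| + 2`** in every finite abelian group `H` hosting `(2,1,1)^k`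
(`CubeNB.n9` on the rotated family `(C, A, B)`, shared letter `|Aⱼ| = 2`). [cite: CohnKleinbergSzegedyUmans2005, Def. 5.1] -/
theorem four_mul_le_card_add_two_of_isSTPP_211 [Fintype H] [DecidableEq H] {k : ℕ}
    (h : ∃ A B C : Fin k → Finset H, IsSTPP A B C ∧ ∀ i, (A i).card = 2 ∧ (B i).card = 1 ∧ (C i).card = 1) :
    4 * k ≤ Fintype.card H + 2 := by
  rcases Nat.eq_zero_or_pos k with hk | hk
  · subst hk; simp
  obtain ⟨A, B, C, hS, hc⟩ := h
  have eA : ∀ i, (A i).card = 2 := fun i => (hc i).1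
  have eB : ∀ i, (B i).card = 1 := fun i => (hc i).2.1
  have eC : ∀ i, (C i).card = 1 := fun i => (hc i).2.2
  have hB : ∀ i, (B i).Nonempty := fun i => Finset.card_pos.1 (by rw [eB i]; omega)
  have hC : ∀ i, (C i).Nonempty := fun i => Finset.card_pos.1 (by rw [eC i]; omega)
  have h9 := CubeNB.n9 (isSTPP_roles_CAB hS) hC hB ⟨0, hk⟩
  simp only [eA, eB, eC, Finset.sum_const, Finset.card_univ, Fintype.card_fin, smul_eq_mul] at h9
  omega

/-- `Nat.card` form of the N9 packing law `4k ≤ |H| + 2` for `(2,1,1)^k`. [cite: CohnKleinbergSzegedyUmans2005, Def. 5.1] -/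
theorem four_mul_le_natCard_add_two_of_isSTPP_211 [Finite H] {k : ℕ}
    (h : ∃ A B C : Fin k → Finset H, IsSTPP A B C ∧ ∀ i, (A i).card = 2 ∧ (B i).card = 1 ∧ (C i).card = 1) :
    4 * k ≤ Nat.card H + 2 := by
  classical
  cases nonempty_fintype H
  rw [Nat.card_eq_fintype_card]; exact four_mul_le_card_add_two_of_isSTPP_211 h

/-- Contrapositive: **no finite abelian group of order `< 4k − 2` hosts `(2,1,1)^k`.** [cite: CohnKleinbergSzegedyUmans2005, Def. 5.1] -/
theorem not_exists_isSTPP_211_of_card_add_two_lt [Finite H] {k : ℕ} (hH : Nat.card H + 2 < 4 * k) :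
    ¬ ∃ A B C : Fin k → Finset H, IsSTPP A B C ∧ ∀ i, (A i).card = 2 ∧ (B i).card = 1 ∧ (C i).card = 1 :=
  fun h => absurd (four_mul_le_natCard_add_two_of_isSTPP_211 h) (by omega)

end Summit.MatrixMultiplication.OmegaCensus
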